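import Summits.Ventures.LatticeQCDFlow.Scoring.U1TorusTopologicalChargePoisson
import Summits.Ventures.LatticeQCDFlow.Scoring.U1TorusTopologicalSusceptibility
import Summits.Ventures.LatticeQCDFlow.Scoring.U1TorusPartitionFunctionBessel
import HarnessLib

/-!
# The topological susceptibility of 2-d `U(1)` on the torus in closed Bessel form

HONEST FRAMING: exact (Metropolis-corrected) sampling algorithms for lattice gauge theory;
figures of merit are autocorrelation/cost numbers at stated couplings and volumes; no
continuum-physics claim.

Venture `LatticeQCDFlow` (cell pub-lqcd), sub-topic `Scoring`; FANOUT row 5 (`s0-sun-a`), GEN-14.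
NEW WORK of the cell (placement rule).  GEN-8 typed the topological-charge law of theory-2's
`topCharge` under `wilsonMeasure u1Rep β` on `(ℤ/L)²`, `P(Q = k) = g_V(2πk)/Σ_j g_V(2πj)`
(`Scoring/U1TorusTopologicalChargeLaw.lean`), `⟨Q²⟩ = Σ_k k² P(Q = k)`
(`Scoring/U1TorusTopologicalChargeMoments.lean`), the denominator in Bessel form
(`Scoring/U1TorusPartitionFunctionBessel.lean`) and `χ_t = ⟨Q²⟩/L²`
(`Scoring/U1TorusTopologicalSusceptibility.lean`), leaving the sector weights `g_V(2πk)` themselves to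
the oracle's quadratures.  With the Poisson summation of the NUMERATOR
(`Scoring/U1TorusTopologicalChargePoisson.lean`) the quadratures disappear: for every `L ≥ 2` and
every real `β`, `V = L²`,

* **`integral_topCharge_sq_eq_besselI`** —
  `⟨Q²⟩_{(ℤ/L)²,β} = (V/(16π⁴)) · Σ_{n∈ℤ} [2π I_{|n|}(β)^{V−1} c_n(β) − (V−1) I_{|n|}(β)^{V−2} s_n(β)²] / Σ_{n∈ℤ} I_{|n|}(β)^V`,
* **`u1TopSusceptibility_eq_besselI`** — the same divided by `L²`,

with the two "incomplete Bessel integrals"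

  `s_n(β) = ∫_{−π}^{π} v sin(nv) e^{β cos v} dv`, `c_n(β) = ∫_{−π}^{π} v² cos(nv) e^{β cos v} dv`

(`∫_{−π}^{π} cos(nv) e^{β cos v} dv = 2π I_{|n|}(β)` being the complete one).  This is the finite-volume
formula behind the oracle's `Q2` / `chi_t` columns (`ORACLE-u1-2d.json`): the `θ`-derivative
`−∂²_θ log Σ_n f(n + θ/2π)^V |_{θ=0}` of the continuum literature on 2-d `U(N)` Yang–Mills, here a
theorem about the Haar-measure lattice model.  At `β = 0` it reads `⟨Q²⟩ = V/12` (the sum of `V`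
independent uniform angles conditioned to close up).  Elementary given the parents; nothing is cited.
-/

noncomputable section

open MeasureTheory Set Real Filter Topology Finset
open scoped ENNReal
open Literature.Analysis.FunctionSpaces
open Literature.MathematicalPhysics.QuantumFieldTheory
open Literature.MathematicalPhysics.QuantumLattice (u1Rep)
open Summit.Ventures.LatticeQCDFlow.Theory2.Lattice (topCharge)

namespace Summit.Ventures.LatticeQCDFlow.Scoring

variable (β : ℝ) {L : ℕ} [NeZero L]

/-! ### 1. The window sum is the full sum -/

/-- The finite window `|k| ≤ L²` already carries the whole second moment of the sector weights:
`Σ_{|k| ≤ L²} k² g_V(2πk) = Σ_{k∈ℤ} k² g_V(2πk)` (`g_V(2πk) = 0` for `|k| > L²/2`). -/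
theorem sum_sq_mul_u1SectorWeight_toReal_eq_tsum (hL : 2 ≤ L) :
    ∑ k ∈ Finset.Icc (-(L ^ 2 : ℤ)) (L ^ 2 : ℤ), (k : ℝ) ^ 2 * (u1SectorWeight β (L ^ 2) k).toReal =
      ∑' k : ℤ, (k : ℝ) ^ 2 * (u1SectorWeight β (L ^ 2) k).toReal := by
  refine (tsum_eq_sum fun k hk => ?_).symm
  have hk' : (L : ℝ) ^ 2 / 2 < |(k : ℝ)| := by
    simp only [Finset.mem_Icc, not_and_or, not_le] at hk
    have hL2 : (0 : ℝ) ≤ (L : ℝ) ^ 2 := by positivity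
    have habs : (L : ℝ) ^ 2 < |(k : ℝ)| := by
      rcases hk with hk | hk
      · have h : (k : ℝ) < -((L : ℝ) ^ 2) := by exact_mod_cast hk
        rw [abs_of_neg (by linarith)]; linarith
      · have h : ((L : ℝ) ^ 2) < (k : ℝ) := by exact_mod_cast hk
        rw [abs_of_pos (by linarith)]; linarith
    linarith
  rw [u1SectorWeight_eq_zero β hL hk', ENNReal.toReal_zero, mul_zero]

/-! ### 2. From the action weight `e^{−β(1−cos v)}` to `e^{β cos v}` -/

/-- `S_n = e^{−β} s_n`. -/
theorem sinMoment_eq_exp_mul (n : ℤ) :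
    ∫ v in (-π)..π, v * Real.sin (n * v) * u1PlaqDensity β v =
      Real.exp (-β) * ∫ v in (-π)..π, v * Real.sin (n * v) * Real.exp (β * Real.cos v) := by
  rw [← intervalIntegral.integral_const_mul]
  refine intervalIntegral.integral_congr fun v _ => ?_
  simp only [u1PlaqDensity]
  rw [show -(β * (1 - Real.cos v)) = -β + β * Real.cos v by ring, Real.exp_add]
  ring

/-- `C_n = e^{−β} c_n`. -/
theorem cosMoment_eq_exp_mul (n : ℤ) :
    ∫ v in (-π)..π, v ^ 2 * Real.cos (n * v) * u1PlaqDensity β v =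
      Real.exp (-β) * ∫ v in (-π)..π, v ^ 2 * Real.cos (n * v) * Real.exp (β * Real.cos v) := by
  rw [← intervalIntegral.integral_const_mul]
  refine intervalIntegral.integral_congr fun v _ => ?_
  simp only [u1PlaqDensity]
  rw [show -(β * (1 - Real.cos v)) = -β + β * Real.cos v by ring, Real.exp_add]
  ring

/-- The dual series of `Scoring/U1TorusTopologicalChargePoisson.lean` with the factors
`(2π)^{V−2} e^{−βV}` pulled out (`V = m + 2`):
`Σ_n [f_n^{V−1} C_n − (V−1) f_n^{V−2} S_n²]
  = (2π)^{V−2} e^{−βV} Σ_n [2π I_{|n|}^{V−1} c_n − (V−1) I_{|n|}^{V−2} s_n²]`. -/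
theorem tsum_secondMoment_eq_mul_tsum (m : ℕ) :
    ∑' n : ℤ, ((2 * π * Real.exp (-β) * besselI n.natAbs β) ^ (m + 1) *
          (∫ v in (-π)..π, v ^ 2 * Real.cos (n * v) * u1PlaqDensity β v) -
        (m + 1 : ℕ) * (2 * π * Real.exp (-β) * besselI n.natAbs β) ^ m *
          (∫ v in (-π)..π, v * Real.sin (n * v) * u1PlaqDensity β v) ^ 2) =
      (2 * π) ^ m * Real.exp (-β) ^ (m + 2) * ∑' n : ℤ,
        (2 * π * besselI n.natAbs β ^ (m + 1) *
            (∫ v in (-π)..π, v ^ 2 * Real.cos (n * v) * Real.exp (β * Real.cos v)) -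
          (m + 1 : ℕ) * besselI n.natAbs β ^ m *
            (∫ v in (-π)..π, v * Real.sin (n * v) * Real.exp (β * Real.cos v)) ^ 2) := by
  rw [← tsum_mul_left]
  refine tsum_congr fun n => ?_
  rw [sinMoment_eq_exp_mul, cosMoment_eq_exp_mul]
  ring

/-! ### 3. `⟨Q²⟩` and `χ_t` in Bessel form -/

/-- **`Z = Σ_n I_{|n|}(β)^{L²} > 0`** for every real `β` and `L ≥ 2` (it is `e^{βL²}` times theory-2's
partition function, `u1_partitionFunction_two_eq_besselI`). -/
theorem tsum_besselI_natAbs_pow_sq_pos (hL : 2 ≤ L) : 0 < ∑' n : ℤ, besselI n.natAbs β ^ (L ^ 2) := by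
  have hV2 : 2 ≤ L ^ 2 := le_trans (by norm_num) (Nat.pow_le_pow_left hL 2)
  have hD := tsum_u1SectorWeight_toReal β hV2
  have hne := tsum_u1SectorWeight_ne β hL
  have hpos : 0 < (∑' k : ℤ, u1SectorWeight β (L ^ 2) k).toReal := ENNReal.toReal_pos hne.1 hne.2
  rw [hD] at hpos
  have hc : 0 < (2 * π) ^ (L ^ 2 - 1) * Real.exp (-β) ^ (L ^ 2) := by positivity
  exact pos_of_mul_pos_right hpos hc.le

/-- **THE SECOND MOMENT OF THE TOPOLOGICAL CHARGE OF 2-d `U(1)` IN BESSEL FORM.**  For every `L ≥ 2`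
and every real `β`, with `V = L²`, `s_n(β) = ∫_{−π}^{π} v sin(nv) e^{β cos v} dv` and
`c_n(β) = ∫_{−π}^{π} v² cos(nv) e^{β cos v} dv`:

  `∫ Q² dμ_{(ℤ/L)²,β} = (V/(16π⁴)) · (Σ_{n∈ℤ} [2π I_{|n|}(β)^{V−1} c_n(β) − (V−1) I_{|n|}(β)^{V−2} s_n(β)²]) / Σ_{n∈ℤ} I_{|n|}(β)^V`

(theory-2's `topCharge` under `wilsonMeasure u1Rep β`; the law `P(Q = k) = g_V(2πk)/Σ_j g_V(2πj)`
with numerator and denominator summed by Poisson summation). -/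
theorem integral_topCharge_sq_eq_besselI (hL : 2 ≤ L) :
    ∫ U, (topCharge U) ^ 2 ∂(wilsonMeasure (d := 2) (L := L) u1Rep β) =
      (L : ℝ) ^ 2 / (16 * π ^ 4) *
        (∑' n : ℤ, (2 * π * besselI n.natAbs β ^ (L ^ 2 - 1) *
            (∫ v in (-π)..π, v ^ 2 * Real.cos (n * v) * Real.exp (β * Real.cos v)) -
          (L ^ 2 - 1 : ℕ) * besselI n.natAbs β ^ (L ^ 2 - 2) *
            (∫ v in (-π)..π, v * Real.sin (n * v) * Real.exp (β * Real.cos v)) ^ 2)) /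
        ∑' n : ℤ, besselI n.natAbs β ^ (L ^ 2) := by
  have hV : 3 ≤ L ^ 2 := le_trans (by norm_num) (Nat.pow_le_pow_left hL 2)
  have hV2 : 2 ≤ L ^ 2 := le_trans (by norm_num) hV
  obtain ⟨m, hm⟩ := Nat.exists_eq_add_of_le' hV2
  have hZpos := tsum_besselI_natAbs_pow_sq_pos β hL
  have hπ : (π : ℝ) ≠ 0 := Real.pi_pos.ne'
  have hLr : ((L ^ 2 : ℕ) : ℝ) = (L : ℝ) ^ 2 := by push_cast; ring
  -- assemble
  rw [integral_topCharge_sq]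
  simp_rw [wilsonMeasure_topCharge_toReal β hL, mul_div_assoc']
  rw [← Finset.sum_div, sum_sq_mul_u1SectorWeight_toReal_eq_tsum β hL,
    tsum_sq_mul_u1SectorWeight_toReal β hV, tsum_u1SectorWeight_toReal β hV2, hm,
    show m + 2 - 1 = m + 1 from rfl, show m + 2 - 2 = m from rfl, tsum_secondMoment_eq_mul_tsum,
    ← hLr, hm]
  rw [hm] at hZpos
  field_simp
  ring

/-- **THE TOPOLOGICAL SUSCEPTIBILITY OF 2-d `U(1)` IN BESSEL FORM.**  For every `L ≥ 2` and every
real `β` (`V = L²`, `s_n`, `c_n` as above):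

  `χ_t(L, β) = (1/(16π⁴)) · (Σ_{n∈ℤ} [2π I_{|n|}(β)^{V−1} c_n(β) − (V−1) I_{|n|}(β)^{V−2} s_n(β)²]) / Σ_{n∈ℤ} I_{|n|}(β)^V`

— the oracle's `chi_t = Q2/V` column as a closed form. -/
theorem u1TopSusceptibility_eq_besselI (hL : 2 ≤ L) :
    u1TopSusceptibility L β =
      1 / (16 * π ^ 4) *
        (∑' n : ℤ, (2 * π * besselI n.natAbs β ^ (L ^ 2 - 1) *
            (∫ v in (-π)..π, v ^ 2 * Real.cos (n * v) * Real.exp (β * Real.cos v)) -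
          (L ^ 2 - 1 : ℕ) * besselI n.natAbs β ^ (L ^ 2 - 2) *
            (∫ v in (-π)..π, v * Real.sin (n * v) * Real.exp (β * Real.cos v)) ^ 2)) /
        ∑' n : ℤ, besselI n.natAbs β ^ (L ^ 2) := by
  have hL0 : (L : ℝ) ^ 2 ≠ 0 := by
    have : (0 : ℝ) < L := by exact_mod_cast Nat.pos_of_ne_zero (NeZero.ne L)
    positivity
  rw [u1TopSusceptibility, integral_topCharge_sq_eq_besselI β hL]
  field_simp

end Summit.Ventures.LatticeQCDFlow.Scoring
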